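import Summits.Ventures.WeilGRH.TwistedFlatTest
import Summits.RiemannHypothesis.RiemannHypothesis.Theorems.GroundBartaEvenWinsBeyondArchPositivity8046
import Literature.NumberTheory.LFunctions.UniformWeilPositivityRH
import HarnessLib

/-!
# GRH arm (rh-explicit, venture WeilGRH): the `q = 1` companion of the flat-window inequality —
  what a `ζ`-rung says about the primes below its horizon

Cell `rh-explicit`, WEIL TRACK (structure seat weil-3, gen7).  Companion of `TwistedFlatTest.lean` (the
`χ`-twisted flat window) for the lead track's `ζ` window form
`weilWindowForm a u = P(u) + 𝓔_a(u) − M_a‖u‖₂²` (Literature `WeilWindowForm.lean`; the structure seat's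
`WeilFormatCWindowClosure.lean`: `WeilPositivityOn a ⟹ weilWindowForm a φ ≥ 0` on Yoshida's `K(a)`).  At
Yoshida's zero mode `χ_0 = (2a)^{-1/2}𝟙_{[-a,a]}` the window form is, in closed form
(`weilWindowForm_chi_zero`; pole entry `polarCoeff a 0 0 = 16 sinh²(a/2)/a`),

  `weilWindowForm a χ_0 = 16 sinh²(a/2)/a − [2Σ_{log n<2a} Λ(n)n^{-1/2}(1 − log n/(2a)) + K₀ − I₀(a)/a]`

(`K₀ = log 4π + γ + 2∫₀^∞(e^{t/2} − 1)dt/(2 sinh t) = log 8π + γ + π/2`, `I₀(a) = ∫₀^∞ e^{t/2}/(2 sinh t)·min(t,2a)dt`).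
Hence the **`ζ` FLAT-WINDOW INEQUALITY** (`zetaFlatWindow_le_of_weilPositivityOn`):

  `WeilPositivityOn a ⟹ 2Σ_{log n<2a} Λ(n)n^{-1/2}(1 − log n/(2a)) + K₀ − I₀(a)/a ≤ 16 sinh²(a/2)/a`

— a CHEBYSHEV-TYPE UPPER BOUND for the smoothed prime sum below `e^{2a}` from each rung: for `ζ` the POLE
pays for the primes (for `χ ≠ χ₀` the CONDUCTOR does, `TwistedFlatTest.lean`).  RH-free at every proved rung
(`zetaFlatWindow_le_8046`, `a ≤ 4023/5000`, `EvenWinsBeyondArch.weilPositivityOn_8046`) and at every `a > 0`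
under RH (`zetaFlatWindow_le_of_riemannHypothesis`, `riemannHypothesis_iff_forall_weilPositivityOn`).  Both
sides are `4e^a/a(1 + o(1))`: the margin is Yoshida's diagonal Gram entry `G(0,0)` (`0.08` at `a = 4023/5000`,
`0.05` at `a = 1`; HOME/rh-explicit-weil-3/flatwindow.py), i.e. the inequality is the PNT-accurate statement
«`ψ`-type sums below `e^{2a}` do not exceed the pole term» that the rung encodes.

No definitions, no named facts.
-/

set_option autoImplicit false

noncomputable section

open Complex Filter Set MeasureTheory
open scoped Real Topology ComplexConjugate ArithmeticFunction.vonMangoldt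

namespace Summit.Ventures.WeilGRH

open Literature.NumberTheory.LFunctions
open Literature.NumberTheory.LFunctions.Yoshida1992 (chi polarCoeff freq)
open Summit.RiemannHypothesis.RiemannHypothesis.Theorems.WeilFormatC

variable {a : ℝ}

/-- **The pole form of the flat window**: `P(χ_0) = 16 sinh²(a/2)/a` (`a > 0`; Yoshida's `polarCoeff a 0 0`:
`2|∫χ_0 cosh(x/2)|² = 2(4 sinh(a/2))²/(2a)`, the `sinh` moment vanishes). -/
theorem weilPoleForm_chi_zero (ha : 0 < a) :
    weilPoleForm (chi a 0) = 16 * Real.sinh (a / 2) ^ 2 / a := by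
  have h := weilPoleSesq_self (chi a 0)
  rw [weilPoleSesq_chi ha 0 0] at h
  have h' := Complex.ofReal_injective h
  rw [← h', polarCoeff]
  simp only [freq, Int.cast_zero, mul_zero, zero_div, add_zero, sub_zero, mul_one, zero_pow two_ne_zero]
  rw [Real.sinh_eq]
  field_simp
  ring

/-- **The `ζ` Dirichlet energy of the flat window**:
`𝓔_a(χ_0) = Σ_{log n<2a} Λ(n)n^{-1/2}(log n)/a + (1/a)∫₀^∞ ρ₀(t) min(t,2a) dt`. -/
theorem weilDirichletEnergy_chi_zero (ha : 0 < a) :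
    weilDirichletEnergy a (chi a 0) =
      (∑ n ∈ weilPrimeIndex a, (Λ n : ℝ) / Real.sqrt n * (Real.log n / a)) +
        1 / a * ∫ t in Ioi (0 : ℝ), weilArchDensity t * min t (2 * a) := by
  unfold weilDirichletEnergy
  congr 1
  · refine Finset.sum_congr rfl fun n hn ↦ ?_
    have hlog : Real.log n < 2 * a := mem_weilPrimeIndex.1 hn
    rw [weilIncrement_chi_zero ha (Real.log_natCast_nonneg n), min_eq_left hlog.le]
  · rw [← integral_const_mul]
    refine setIntegral_congr_fun measurableSet_Ioi fun t (ht : 0 < t) ↦ ?_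
    rw [weilIncrement_chi_zero ha ht.le]
    field_simp

/-- **THE `ζ` WINDOW FORM OF THE FLAT WINDOW, IN CLOSED FORM** (`a > 0`):
`weilWindowForm a χ_0 = 16 sinh²(a/2)/a − [2Σ_{log n<2a}Λ(n)n^{-1/2}(1 − log n/(2a)) + K₀ − I₀(a)/a]`. -/
theorem weilWindowForm_chi_zero (ha : 0 < a) :
    weilWindowForm a (chi a 0) =
      16 * Real.sinh (a / 2) ^ 2 / a -
        (2 * (∑ n ∈ weilPrimeIndex a, (Λ n : ℝ) / Real.sqrt n * (1 - Real.log n / (2 * a))) +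
          (Real.log (4 * π) + Real.eulerMascheroniConstant +
            2 * ∫ t in Ioi (0 : ℝ), (Real.exp (t / 2) - 1) / (2 * Real.sinh t)) -
          1 / a * ∫ t in Ioi (0 : ℝ), weilArchDensity t * min t (2 * a)) := by
  rw [weilWindowForm, weilPoleForm_chi_zero ha, weilDirichletEnergy_chi_zero ha, integral_norm_sq_chi_zero ha,
    mul_one]
  unfold weilMarkovConstant
  have hsum : (∑ n ∈ weilPrimeIndex a, (Λ n : ℝ) / Real.sqrt n * (Real.log n / a)) -
      2 * ∑ n ∈ weilPrimeIndex a, (Λ n : ℝ) / Real.sqrt n =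
      -(2 * ∑ n ∈ weilPrimeIndex a, (Λ n : ℝ) / Real.sqrt n * (1 - Real.log n / (2 * a))) := by
    rw [Finset.mul_sum, Finset.mul_sum, ← Finset.sum_sub_distrib, ← Finset.sum_neg_distrib]
    refine Finset.sum_congr rfl fun n _ ↦ ?_
    field_simp
    ring
  linarith [hsum]

/-- **THE `ζ` FLAT-WINDOW INEQUALITY — what a `ζ`-rung says about the primes below `e^{2a}`.**  For
`a > 0`: `WeilPositivityOn a ⟹ 2Σ_{log n<2a} Λ(n)n^{-1/2}(1 − log n/(2a)) + K₀ − I₀(a)/a ≤ 16 sinh²(a/2)/a`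
(the pole pays for the primes).  RH-free. -/
theorem zetaFlatWindow_le_of_weilPositivityOn (ha : 0 < a) (hW : WeilPositivityOn a) :
    2 * (∑ n ∈ weilPrimeIndex a, (Λ n : ℝ) / Real.sqrt n * (1 - Real.log n / (2 * a))) +
        (Real.log (4 * π) + Real.eulerMascheroniConstant +
          2 * ∫ t in Ioi (0 : ℝ), (Real.exp (t / 2) - 1) / (2 * Real.sinh t)) -
        1 / a * ∫ t in Ioi (0 : ℝ), weilArchDensity t * min t (2 * a) ≤
      16 * Real.sinh (a / 2) ^ 2 / a := by
  have h := weilWindowForm_nonneg_of_weilPositivityOn_of_mem_K ha hW (Yoshida1992.chi_mem_K a 0)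
  rw [weilWindowForm_chi_zero ha] at h
  linarith

/-- **At the frontier rung and below, unconditionally**: for `0 < a ≤ 4023/5000`
(`EvenWinsBeyondArch.weilPositivityOn_8046` and monotonicity of the rungs). -/
theorem zetaFlatWindow_le_of_le_8046 (ha : 0 < a) (ha' : a ≤ 4023 / 5000) :
    2 * (∑ n ∈ weilPrimeIndex a, (Λ n : ℝ) / Real.sqrt n * (1 - Real.log n / (2 * a))) +
        (Real.log (4 * π) + Real.eulerMascheroniConstant +
          2 * ∫ t in Ioi (0 : ℝ), (Real.exp (t / 2) - 1) / (2 * Real.sinh t)) -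
        1 / a * ∫ t in Ioi (0 : ℝ), weilArchDensity t * min t (2 * a) ≤
      16 * Real.sinh (a / 2) ^ 2 / a :=
  zetaFlatWindow_le_of_weilPositivityOn ha
    (Summit.RiemannHypothesis.RiemannHypothesis.Theorems.EvenWinsBeyondArch.weilPositivityOn_8046.mono ha')

/-- **Under RH, at every window**: `RiemannHypothesis ⟹` the `ζ` flat-window inequality for all `a > 0`. -/
theorem zetaFlatWindow_le_of_riemannHypothesis (hRH : RiemannHypothesis) (ha : 0 < a) :
    2 * (∑ n ∈ weilPrimeIndex a, (Λ n : ℝ) / Real.sqrt n * (1 - Real.log n / (2 * a))) +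
        (Real.log (4 * π) + Real.eulerMascheroniConstant +
          2 * ∫ t in Ioi (0 : ℝ), (Real.exp (t / 2) - 1) / (2 * Real.sinh t)) -
        1 / a * ∫ t in Ioi (0 : ℝ), weilArchDensity t * min t (2 * a) ≤
      16 * Real.sinh (a / 2) ^ 2 / a :=
  zetaFlatWindow_le_of_weilPositivityOn ha (riemannHypothesis_iff_forall_weilPositivityOn.1 hRH a ha)

end Summit.Ventures.WeilGRH

end
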